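import Summits.CriticalPhenomena.PercolationContinuityZ3.Theorems.Transplant.PlanarSkeletonFrmFromDefs
import Summits.CriticalPhenomena.PercolationContinuityZ3.Theorems.Transplant.SkelFrmFromBChoiceRootPrefix
import Summits.CriticalPhenomena.PercolationContinuityZ3.Theorems.Transplant.SkelFrmBChoiceRootPrefix
import Summits.CriticalPhenomena.PercolationContinuityZ3.Theorems.Transplant.SkelFrmFromBChoiceRootRunY
import Summits.CriticalPhenomena.PercolationContinuityZ3.Theorems.Transplant.SkelFrmBChoiceRootRunY
import Summits.CriticalPhenomena.PercolationContinuityZ3.Theorems.Transplant.SkelFrmFromBParamsCorrKGLen3S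
import Summits.CriticalPhenomena.PercolationContinuityZ3.Theorems.Transplant.SkelFrmBParamsCorrKGLen3S
import HarnessLib
import Summits.CriticalPhenomena.PercolationContinuityZ3.Theorems.Transplant.SkelFrmBChoiceRootLen
/-!
# U-WAVE PORT (RULING D-U, lead g21 2026-08-26; WAVE-U-MANIFEST v3.0 row «SkelFrmBChoiceRootLen» ↦ «SkelFrmFromBChoiceRootLen») of the tree module
# `Transplant/SkelFrmBChoiceRootLen` onto the carrier `PlanarSkeletonFrmFrom` (frames only, cylinders connected from width `ℓ₀` on)

ORIGINAL TITLE: N2 (frames-only node `SamePDropOfSkeletonFrm₁`, OPEN), (R) column — **THE LENGTH ROWS `hlen` OF BOTH ROOT SKELETONS AT THE VALUES OF RECORD**: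

builds on p205010 (kernel theorem, internal audit signed; external expert review pending) — nothing in this file uses p205010; NOTHING is claimed about the
OPEN node U `SamePDropOfSkeletonFrmFrom₁` (nor U_s / the end state).  Lane `prim-bschramm`, seat `prim-hp-8 gen 53 (U-wave port pen, family P-hp8; tool of record = p3-g26 port_u.py)`; helper file
(`--supports stmt-CriticalPhenomena-4575 --as helper`).  PORT RULES r1–r4 of RULING D-U: declaration order and proof texts are those of the original,
byte-identical except (i) the carrier token `PlanarSkeletonFrm ↦ PlanarSkeletonFrmFrom` (binders, `namespace`/`end` lines, qualified names of twinned
declarations), (ii) carrier-FREE declarations of the original (φ-level `Skelφ…` blocks and namespace-only arithmetic residents) are NOT re-declared —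
this file imports the original and `export`s the twin-free residents (POLICY T / treatment (m1)); residents whose statement mentions a twinned
constant are copied, (iii) every carrier-binding declaration keeps its explicit binder `(Φ : PlanarSkeletonFrmFrom G)` in its own signature (r2).  Docstrings and citations are the original's.  Manifest row idx 164 (level 18; flags verbatim); filed by the hp-8 lineage under RULING M-11 (family P-hp8).
-/

noncomputable section

open scoped Classical

namespace Summit.CriticalPhenomena.PercolationContinuityZ3.Theorems.Transplant

namespace PlanarSkeletonFrmFrom

namespace NegB

open Literature.Probability.Percolation Literature.Probability.LatticeModels SimpleGraph
open SkelConc (Consts)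
open Skelφ (shearUnit kgSL KGRows KGYRows kgM₁ kgM₂ kgM₁Y kgM₂Y)
open Neg

namespace KS

section Len

variable (κ : Consts) {V : Type} [DecidableEq V] [Countable V] {G : SimpleGraph V} [G.LocallyFinite] (Φ : PlanarSkeletonFrmFrom G) (t : V) (p : unitInterval)
  (D : Skelφ.StepI.DataNS V) (mk g f qx Wx qxY WxY : ℕ)

/-- **`hlen`, FIRST AXIS** at `HK := kgRows0_of mk qx Wx`, `N := N_R` (bridge frame length `0`): `0 + 1 + S.N ≤ LfQ κ.K₀` under `KGRes3`. [this work] -/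
theorem hlen_R1 (κ : Consts) {V : Type} [DecidableEq V] [Countable V] {G : SimpleGraph V} [G.LocallyFinite] (Φ : PlanarSkeletonFrmFrom G) (t : V) (p : unitInterval) (D : Skelφ.StepI.DataNS V) (mk : ℕ) (g : ℕ) (f : ℕ) (qx : ℕ) (Wx : ℕ) (hN : EqNumL κ Φ t p D g f) (hg : gFloorKG κ Φ t p D mk ≤ g) (hg2 : 40 * Neg.K κ * KS0.R'0 κ Φ t p D mk ≤ g)
    (hqx : qx ≤ 100 * nL κ Φ t p D g f) (hWx : (Wx : ℤ) ≤ 20 * kgSL (nL κ Φ t p D g f) (ℓL κ Φ t p D g f) (hL κ Φ t p D g f)) (hf : KS.fxR0 κ Φ t p D mk ≤ f)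
    (hx : KGRes3 κ Φ t p D g f qx Wx) :
    0 + 1 + (Skelφ.kgCorrSched ((kgRows0_of κ Φ t p D g f mk qx Wx hN hg).kgVals_ok₁ (KS.kgNR κ Φ t p D mk g f qx Wx)) ((kgRows0_of κ Φ t p D g f mk qx Wx hN hg).kgVals_ok₂ (KS.kgNR κ Φ t p D mk g f qx Wx)) ((kgRows0_of κ Φ t p D g f mk qx Wx hN hg).kgVals_split (KS.kgNR κ Φ t p D mk g f qx Wx))).N ≤ LfQ κ.K₀ := by
  have H := (kgRows0_of κ Φ t p D g f mk qx Wx hN hg)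
  have hmono := H.kgSchedLen_mono (kgNR_le_kgNv0 κ Φ t p D mk g f qx Wx hN hg hg2 hqx hWx hf)
  have hb := kgSchedN_le_LfQ3 κ Φ t p D g f mk qx Wx hN hg hx
  rw [(Skelφ.kgCorrSched_params ((kgRows0_of κ Φ t p D g f mk qx Wx hN hg).kgVals_ok₁ (KS.kgNR κ Φ t p D mk g f qx Wx)) ((kgRows0_of κ Φ t p D g f mk qx Wx hN hg).kgVals_ok₂ (KS.kgNR κ Φ t p D mk g f qx Wx)) ((kgRows0_of κ Φ t p D g f mk qx Wx hN hg).kgVals_split (KS.kgNR κ Φ t p D mk g f qx Wx))).1]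
  omega

/-- **`hlen`, SECOND AXIS** at the prefix `kgRows0_of mk 0 0`, `Nx = 30` and the root y′-corridor `kgYRows0_of mk qxY WxYR`, `Ny = kgNYv0 mk qxY WxY`
(bridge frame length `0`): `0 + 1 + S_x.N + 1 + S_y.N ≤ LfQ κ.K₀` under `KGResY3`. [this work] -/
theorem hlen_R2 (κ : Consts) {V : Type} [DecidableEq V] [Countable V] {G : SimpleGraph V} [G.LocallyFinite] (Φ : PlanarSkeletonFrmFrom G) (t : V) (p : unitInterval) (D : Skelφ.StepI.DataNS V) (mk : ℕ) (g : ℕ) (f : ℕ) (qxY : ℕ) (WxY : ℕ) (hN : EqNumL κ Φ t p D g f) (hg : gFloorKG κ Φ t p D mk ≤ g) (hg2 : 40 * Neg.K κ * KS0.R'0 κ Φ t p D mk ≤ g)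
    (hx : KGResY3 κ Φ t p D g f qxY WxY) :
    0 + 1 + (Skelφ.kgCorrSched ((kgRows0_of κ Φ t p D g f mk 0 0 hN hg).kgVals_ok₁ 30) ((kgRows0_of κ Φ t p D g f mk 0 0 hN hg).kgVals_ok₂ 30) ((kgRows0_of κ Φ t p D g f mk 0 0 hN hg).kgVals_split 30)).N + 1 + (Skelφ.kgCorrSchedY (kgYRows0_of κ Φ t p D g f mk qxY (KS.WxYR κ Φ t p D mk g f WxY) hN hg).hn (kgYRows0_of κ Φ t p D g f mk qxY (KS.WxYR κ Φ t p D mk g f WxY) hN hg).hv (kgYRows0_of κ Φ t p D g f mk qxY (KS.WxYR κ Φ t p D mk g f WxY) hN hg).hlay ((kgYRows0_of κ Φ t p D g f mk qxY (KS.WxYR κ Φ t p D mk g f WxY) hN hg).kgYVals_ok₁ (kgNYv0 κ Φ t p D g f mk qxY WxY)) ((kgYRows0_of κ Φ t p D g f mk qxY (KS.WxYR κ Φ t p D mk g f WxY) hN hg).kgYVals_ok₂ (kgNYv0 κ Φ t p D g f mk qxY WxY)) ((kgYRows0_of κ Φ t p D g f mk qxY (KS.WxYR κ Φ t p D mk g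 f WxY) hN hg).kgYVals_split (kgNYv0 κ Φ t p D g f mk qxY WxY))).N ≤ LfQ κ.K₀ := by
  have hP := schedLenP_le κ Φ t p D mk g f hN hg hg2
  have hY := schedLenY_R_le κ Φ t p D mk g f qxY WxY hN hg (kgNYv0 κ Φ t p D g f mk qxY WxY)
  have hb := kgSchedNY_le_LfQ3_slack κ Φ t p D g f mk qxY WxY hN hg hx
  rw [(Skelφ.kgCorrSched_params ((kgRows0_of κ Φ t p D g f mk 0 0 hN hg).kgVals_ok₁ 30) ((kgRows0_of κ Φ t p D g f mk 0 0 hN hg).kgVals_ok₂ 30) ((kgRows0_of κ Φ t p D g f mk 0 0 hN hg).kgVals_split 30)).1,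
    (Skelφ.kgCorrSchedY_params (kgYRows0_of κ Φ t p D g f mk qxY (KS.WxYR κ Φ t p D mk g f WxY) hN hg).hn (kgYRows0_of κ Φ t p D g f mk qxY (KS.WxYR κ Φ t p D mk g f WxY) hN hg).hv (kgYRows0_of κ Φ t p D g f mk qxY (KS.WxYR κ Φ t p D mk g f WxY) hN hg).hlay ((kgYRows0_of κ Φ t p D g f mk qxY (KS.WxYR κ Φ t p D mk g f WxY) hN hg).kgYVals_ok₁ (kgNYv0 κ Φ t p D g f mk qxY WxY)) ((kgYRows0_of κ Φ t p D g f mk qxY (KS.WxYR κ Φ t p D mk g f WxY) hN hg).kgYVals_ok₂ (kgNYv0 κ Φ t p D g f mk qxY WxY)) ((kgYRows0_of κ Φ t p D g f mk qxY (KS.WxYR κ Φ t p D mk g f WxY) hN hg).kgYVals_split (kgNYv0 κ Φ t p D g f mk qxY WxY))).1]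
  rw [Nx_eq] at hP
  omega

end Len

end KS

end NegB

end PlanarSkeletonFrmFrom

end Summit.CriticalPhenomena.PercolationContinuityZ3.Theorems.Transplant

end
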